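import Literature.NumberTheory.Transcendental.KirbyWeakSchanuelAx
import Literature.NumberTheory.Transcendental.EclPregeometryProofs
import Summits.Schanuel.Schanuel.Theses.RootDecomp1

/-!
# RootDecomp1 — support item K: span-minimal counterexamples are exponentially algebraic

Proves the support item `EssentialCounterexamplesInEcl` (stmt-Schanuel-24395) of
route-Schanuel-RootDecomp1 (root decomposition cell `decomp-schanuel`, lens-1 «EssentialDimension»):
if `x : Fin n → ℂ` is ℚ-linearly independent, every shorter ℚ-independent tuple inside `span_ℚ x`
satisfies Schanuel (span-minimality) and `trdeg ℚ(x, eˣ) < n`, then every `x i ∈ ecl ∅`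
[cite: Kirby2010, Prop. 7.2 in span-minimal form].

THE ARGUMENT is Kirby's reduction exactly as landed in
`Literature/NumberTheory/Transcendental/SchanuelEclEmptyProofs.lean`
(`schanuelConjecture_iff_ecl_empty_of_kirby`), with the hypothesis «Schanuel on tuples from `ecl ∅`»
replaced by span-minimality: write `V = span_ℚ x = W ⊕ U` with `W = V ∩ ecl ∅`; if some `x i ∉ ecl ∅`
then `U ≠ 0`, so `k = dim W < n` and span-minimality gives `trdeg ℚ(y, e^y) ≥ k` for a (denominator-cleared)
basis `y` of `W`; Kirby's relative Schanuel theorem over `ecl ∅` (tree theorem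
`kirby_relative_schanuel_complex_holds`, Kirby 2010 Thm 1.2 from Ax 1971) gives
`trdeg_{ℚ(ecl ∅)} (z, e^z) ≥ m = dim U` for a basis `z` of `U`, hence `≥ m` over the smaller base
`ℚ(y, e^y) ⊆ ℚ(ecl ∅)` (`trdeg_adjoin_le_of_le`; `ecl ∅` is exp-closed, `Kirby2010_ecl_isExpSubfield_holds`);
the tower law adds up to `n ≤ trdeg ℚ(x, eˣ)`, contradicting the defect.  This file defines nothing;
landed by the census seat (prover role) of the cell; 0 sorry.
-/

set_option linter.dupNamespace false

noncomputable section

open Complex IntermediateField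

namespace Summit.Schanuel.Schanuel.Theorems.RootDecomp1EssentialInEcl

open Summit.Schanuel.Schanuel.Theses.RootDecomp1
open Literature.NumberTheory.Transcendental

open Submodule in
/-- Item stmt-Schanuel-24395 (`EssentialCounterexamplesInEcl`, piece K of route-Schanuel-RootDecomp1):
a span-minimal counterexample to Schanuel has all its coordinates in `ecl ∅`
[cite: Kirby2010, Prop. 7.2; Ax1971, Thm. 3]. -/
theorem essentialCounterexamplesInEcl_holds : EssentialCounterexamplesInEcl := by
  intro n x hx hmin hlt
  by_contra hnot
  push Not at hnot
  obtain ⟨i₀, hi₀⟩ := hnot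
  have hrel := Literature.NumberTheory.Transcendental.kirby_relative_schanuel_complex_holds
  obtain ⟨⟨SE, hSE⟩, hexp⟩ := Literature.NumberTheory.Transcendental.Kirby2010_ecl_isExpSubfield_holds ℂ ∅
  -- `E = ecl ∅` as a `ℚ`-subspace of `ℂ`
  let Eq : Submodule ℚ ℂ :=
    { carrier := ecl (∅ : Set ℂ)
      add_mem' := fun {a b} ha hb => by
        rw [← hSE] at ha hb ⊢; exact SE.add_mem ha hb
      zero_mem' := by rw [← hSE]; exact SE.zero_mem
      smul_mem' := fun q {a} ha => by
        rw [← hSE] at ha ⊢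
        rw [Rat.smul_def]
        exact SE.mul_mem (SubfieldClass.ratCast_mem SE q) ha }
  have hEq : (Eq : Set ℂ) = ecl (∅ : Set ℂ) := rfl
  have hspanE : span ℚ (ecl (∅ : Set ℂ)) = Eq := by rw [← hEq, span_eq]
  -- the `ℚ`-span `V` of `x̄`, `W = V ∩ E` and a complement `U` of `W` in `V`
  set V : Submodule ℚ ℂ := span ℚ (Set.range x) with hV
  haveI : FiniteDimensional ℚ V := FiniteDimensional.span_of_finite ℚ (Set.finite_range x)
  set W : Submodule ℚ ℂ := V ⊓ Eq with hW
  obtain ⟨U', hU'⟩ := W.exists_isCompl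
  set U : Submodule ℚ ℂ := V ⊓ U' with hU
  haveI : FiniteDimensional ℚ W := Submodule.finiteDimensional_of_le inf_le_left
  haveI : FiniteDimensional ℚ U := Submodule.finiteDimensional_of_le inf_le_left
  have hWU_sup : W ⊔ U = V := by
    rw [hU, inf_comm, ← sup_inf_assoc_of_le U' (inf_le_left : W ≤ V), hU'.sup_eq_top, top_inf_eq]
  have hWU_disj : Disjoint W U := hU'.disjoint.mono_right inf_le_right
  have hUE_disj : Disjoint U Eq := by
    rw [disjoint_def]
    intro a haU haE
    exact (disjoint_def.mp hWU_disj) a ⟨inf_le_left (b := U') haU, haE⟩ haU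
  -- dimensions
  set k := Module.finrank ℚ W
  set m := Module.finrank ℚ U
  have hn : k + m = n := by
    have h1 := Submodule.finrank_sup_add_finrank_inf_eq W U
    rw [hWU_disj.eq_bot, finrank_bot, add_zero, hWU_sup] at h1
    rw [← h1, hV, finrank_span_eq_card hx, Fintype.card_fin]
  -- the dark coordinate `x i₀` forces `W ≠ V`, hence `k < n`
  have hkn : k < n := by
    by_contra hkn
    have hkV : Module.finrank ℚ W = Module.finrank ℚ V := by
      apply le_antisymm (Submodule.finrank_mono inf_le_left)
      rw [hV, finrank_span_eq_card hx, Fintype.card_fin]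
      exact not_lt.mp hkn
    have hWV : W = V := Submodule.eq_of_le_of_finrank_eq inf_le_left hkV
    have hxV : x i₀ ∈ V := subset_span ⟨i₀, rfl⟩
    rw [← hWV] at hxV
    exact hi₀ hxV.2
  -- bases
  let bW := Module.finBasis ℚ W
  let bU := Module.finBasis ℚ U
  let y : Fin k → ℂ := fun i => (bW i : ℂ)
  let z : Fin m → ℂ := fun j => (bU j : ℂ)
  have hy_mem : ∀ i, y i ∈ ecl (∅ : Set ℂ) := fun i => ((bW i).2 : (bW i : ℂ) ∈ V ⊓ Eq).2
  have hy_V : ∀ i, y i ∈ V := fun i => ((bW i).2 : (bW i : ℂ) ∈ V ⊓ Eq).1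
  have hz_U : ∀ j, z j ∈ U := fun j => (bU j).2
  have hz_V : ∀ j, z j ∈ V := fun j => inf_le_left (b := U') (hz_U j)
  have hy_li : LinearIndependent ℚ y := bW.linearIndependent.map' W.subtype W.ker_subtype
  have hz_li : LinearIndependent ℚ z := bU.linearIndependent.map' U.subtype U.ker_subtype
  -- clearing denominators
  choose Ny hNy hNy_mem using fun i => Literature.NumberTheory.Transcendental.exists_nsmul_mem_span_int x (hy_V i)
  choose Nz hNz hNz_mem using fun j => Literature.NumberTheory.Transcendental.exists_nsmul_mem_span_int x (hz_V j)
  let cy : Fin k → ℚˣ := fun i => Units.mk0 (Ny i : ℚ) (Nat.cast_ne_zero.mpr (hNy i))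
  let cz : Fin m → ℚˣ := fun j => Units.mk0 (Nz j : ℚ) (Nat.cast_ne_zero.mpr (hNz j))
  let y' : Fin k → ℂ := fun i => (Ny i : ℚ) • y i
  let z' : Fin m → ℂ := fun j => (Nz j : ℚ) • z j
  have hy'_eq : cy • y = y' := by
    funext i; simp only [Pi.smul_apply', cy, y', Units.smul_def, Units.val_mk0]
  have hz'_eq : cz • z = z' := by
    funext j; simp only [Pi.smul_apply', cz, z', Units.smul_def, Units.val_mk0]
  have hy'_li : LinearIndependent ℚ y' := hy'_eq ▸ hy_li.units_smul cy
  have hz'_li : LinearIndependent ℚ z' := hz'_eq ▸ hz_li.units_smul cz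
  have hy'_mem : ∀ i, y' i ∈ ecl (∅ : Set ℂ) := fun i => Eq.smul_mem _ (hy_mem i)
  have hy'_V : ∀ i, y' i ∈ Submodule.span ℚ (Set.range x) := fun i => V.smul_mem _ (hy_V i)
  have hz'_U : ∀ j, z' j ∈ U := fun j => U.smul_mem _ (hz_U j)
  have hz'_modE : LinearIndependent ℚ ((span ℚ (ecl (∅ : Set ℂ))).mkQ ∘ z') := by
    refine hz'_li.map ?_
    rw [ker_mkQ, hspanE]
    exact hUE_disj.mono_left (span_le.mpr (Set.range_subset_iff.mpr hz'_U))
  -- the field-theoretic estimate (span-minimality replaces «Schanuel on ecl ∅»)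
  set Sy := Set.range y' ∪ Set.range (Complex.exp ∘ y') with hSy
  set Sz := Set.range z' ∪ Set.range (Complex.exp ∘ z') with hSz
  set Ky := adjoin ℚ Sy with hKy
  set L := adjoin ℚ (ecl (∅ : Set ℂ)) with hL
  have hk : (k : Cardinal) ≤ Algebra.trdeg ℚ Ky := hmin k hkn y' hy'_li hy'_V
  have hm₀ : (m : Cardinal) ≤ Algebra.trdeg L (adjoin L Sz) := hrel m z' hz'_modE
  have hKyL : Ky ≤ L := by
    rw [hKy, adjoin_le_iff]
    rintro a (⟨i, rfl⟩ | ⟨i, rfl⟩)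
    · exact subset_adjoin ℚ _ (hy'_mem i)
    · exact subset_adjoin ℚ _ (hexp _ (hy'_mem i))
  have hm : (m : Cardinal) ≤ Algebra.trdeg Ky (adjoin Ky Sz) :=
    hm₀.trans (Literature.NumberTheory.Transcendental.trdeg_adjoin_le_of_le hKyL Sz)
  have hkm : (k : Cardinal) + m ≤ Algebra.trdeg ℚ (adjoin ℚ (Sy ∪ Sz)) :=
    Literature.NumberTheory.Transcendental.add_le_trdeg_adjoin_union Sy Sz hk hm
  -- comparison with `ℚ(x̄, e^{x̄})`
  set Kx := adjoin ℚ (Set.range x ∪ Set.range (Complex.exp ∘ x)) with hKx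
  have hle : adjoin ℚ (Sy ∪ Sz) ≤ Kx := by
    rw [adjoin_le_iff]
    rintro a ((⟨i, rfl⟩ | ⟨i, rfl⟩) | (⟨j, rfl⟩ | ⟨j, rfl⟩))
    · exact (Literature.NumberTheory.Transcendental.mem_adjoin_of_mem_span_int x (hNy_mem i)).1
    · exact (Literature.NumberTheory.Transcendental.mem_adjoin_of_mem_span_int x (hNy_mem i)).2
    · exact (Literature.NumberTheory.Transcendental.mem_adjoin_of_mem_span_int x (hNz_mem j)).1
    · exact (Literature.NumberTheory.Transcendental.mem_adjoin_of_mem_span_int x (hNz_mem j)).2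
  have hfin : Algebra.trdeg ℚ (adjoin ℚ (Sy ∪ Sz)) ≤ Algebra.trdeg ℚ Kx :=
    trdeg_le_of_injective (inclusion hle) (inclusion_injective hle)
  have hnle : (n : Cardinal) ≤ Algebra.trdeg ℚ Kx :=
    calc (n : Cardinal) = (k : Cardinal) + m := by rw [← hn, Nat.cast_add]
      _ ≤ Algebra.trdeg ℚ (adjoin ℚ (Sy ∪ Sz)) := hkm
      _ ≤ Algebra.trdeg ℚ Kx := hfin
  exact absurd hlt (not_lt.mpr hnle)

end Summit.Schanuel.Schanuel.Theorems.RootDecomp1EssentialInEcl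

end
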